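import Summits.Ventures.PercRepro.S1SpreadSeriesBase

/-!
# PercRepro — TRIANGLES OF A SPREAD CORE, PART A0: THE BASIC LEMMAS (p1, gen 35)

`proofs/P1-S2-CORANK6.md` §4r. A TRIANGLE is a circuit of size `3` (a 3-point line). In an e-free core lines have `≤ 3` points
(`ncard_le_three_of_eRk_le_two`), so two distinct triangles share at most one point (`tri_eq_of_pair_mem`); under SPREAD a set of rank
`≤ r ≤ 5` has at most `r + 3` points (`ncard_le_add_three_of_eRk_le`). THE COVERED-TRIANGLE LEMMA (`exists_six_of_covered_tri`, Part A = `S1SpreadTriangles`): if a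
triangle `T = {x, y, z}` has NO PRIVATE POINT — `x`, `y`, `z` lie on three further triangles `Ta`, `Tb`, `Tc` — then the core contains a
six-point set of rank `≤ 3` (the `M(K₄)` configuration). Proof: `z ∈ cl {x, y} ⊆ cl (Ta ∪ Tb)`, and with `Tc = {z, w₁, w₂}` the rank of
`U = Ta ∪ Tb ∪ Tc` exceeds that of `Ta ∪ Tb` by at most `1`, and by `0` as soon as one of `w₁, w₂` lies in `Ta ∪ Tb`; counting points against
the spread bound leaves only the case `|Ta ∪ Tb| = 5` (the two triangles meet) with `w₁, w₂ ∈ Ta ∪ Tb`, where `U` has six points and rank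
`≤ 3`; the case `|Ta ∪ Tb| = 6` with both `w`'s old is killed by the coplanarity of the lines `T` and `Tc` through `z`. Part B
(`S1SpreadTrianglesCap`) turns this into `s₃ ≤ nullity`. Axioms: standard.
-/

open scoped Matroid

namespace PercRepro

namespace S1

open Set

variable {α : Type}

/-- **Lines of an e-free core have at most `3` points.** -/
theorem ncard_le_three_of_eRk_le_two (M : Matroid α) [M.Finite]
    (hfree : ∀ e ∈ M.E, ∃ A ⊆ M.E \ {e}, e ∉ M.closure A ∧ e ∉ M.closure ((M.E \ {e}) \ A))
    {X : Set α} (hX : X ⊆ M.E) (h2 : M.eRk X ≤ 2) : X.ncard ≤ 3 := by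
  have := ThmN.ncard_add_one_le_two_pow_of_eRk_le M (ThmN.not_isLoop_of_free M hfree) hfree 2 X hX h2
  omega

/-- **Under spread, a set of rank `≤ r ≤ 5` has at most `r + 3` points.** -/
theorem ncard_le_add_three_of_eRk_le (M : Matroid α) [M.Finite]
    (hns : ¬ ∃ W ⊆ M.E, W.ncard ≤ 9 ∧ W.encard = M.eRk W + 4)
    {X : Set α} (hX : X ⊆ M.E) {r : ℕ} (hr5 : r ≤ 5) (hXr : M.eRk X ≤ r) : X.ncard ≤ r + 3 := by
  have := S2.ncard_le_of_eRk_le_of_not_nullity M 4 9 (by norm_num) hns hX hr5 hXr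
  omega

/-- A triangle has rank `2`. -/
theorem eRk_eq_two_of_tri (M : Matroid α) [M.Finite] {T : Set α} (hT : M.IsCircuit T) (h3 : T.ncard = 3) :
    M.eRk T = 2 := by
  have h := hT.eRk_add_one_eq
  have hTf : T.Finite := M.ground_finite.subset hT.subset_ground
  rw [← hTf.cast_ncard_eq, h3] at h
  obtain ⟨r, hr⟩ := exists_eRk_eq_coe M T
  rw [hr] at h ⊢
  have : r + 1 = 3 := by exact_mod_cast h
  have : r = 2 := by omega
  rw [this]
  rfl

/-- A point of an e-free core has rank `1` (no loops). -/
theorem eRk_singleton_eq_one_of_hfree (M : Matroid α) [M.Finite]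
    (hfree : ∀ e ∈ M.E, ∃ A ⊆ M.E \ {e}, e ∉ M.closure A ∧ e ∉ M.closure ((M.E \ {e}) \ A))
    {u : α} (hu : u ∈ M.E) : M.eRk {u} = 1 :=
  Matroid.IsNonloop.eRk_eq ⟨ThmN.not_isLoop_of_free M hfree u hu, hu⟩

/-- **A triangle lies in the closure of any two of its points.** -/
theorem tri_subset_closure_pair (M : Matroid α) [M.Finite] {T : Set α} (hT : M.IsCircuit T) (h3 : T.ncard = 3)
    {x y : α} (hx : x ∈ T) (hy : y ∈ T) (hxy : x ≠ y) : T ⊆ M.closure {x, y} := by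
  have hTf : T.Finite := M.ground_finite.subset hT.subset_ground
  have hxyE : ({x, y} : Set α) ⊆ M.E := by
    intro s hs
    simp only [mem_insert_iff, mem_singleton_iff] at hs
    rcases hs with rfl | rfl
    · exact hT.subset_ground hx
    · exact hT.subset_ground hy
  intro t ht
  by_cases htx : t = x
  · subst htx; exact M.subset_closure _ hxyE (by simp)
  by_cases hty : t = y
  · subst hty; exact M.subset_closure _ hxyE (by simp)
  have hsub : ({x, y} : Set α) ⊆ T \ {t} := by
    intro s hs
    simp only [mem_insert_iff, mem_singleton_iff] at hs
    rcases hs with rfl | rfl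
    · exact ⟨hx, fun h => htx (mem_singleton_iff.1 h).symm⟩
    · exact ⟨hy, fun h => hty (mem_singleton_iff.1 h).symm⟩
  have heq : T \ {t} = {x, y} := by
    symm
    exact Set.eq_of_subset_of_ncard_le hsub (by rw [ncard_sdiff_singleton_of_mem ht, h3, ncard_pair hxy])
      (hTf.subset sdiff_subset)
  have := hT.mem_closure_sdiff_singleton_of_mem ht
  rwa [heq] at this

/-- **Two triangles sharing two points coincide** (a 4-point line is impossible). -/
theorem tri_eq_of_pair_mem (M : Matroid α) [M.Finite]
    (hfree : ∀ e ∈ M.E, ∃ A ⊆ M.E \ {e}, e ∉ M.closure A ∧ e ∉ M.closure ((M.E \ {e}) \ A))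
    {T T' : Set α} (hT : M.IsCircuit T) (h3 : T.ncard = 3) (hT' : M.IsCircuit T') (h3' : T'.ncard = 3)
    {x y : α} (hxy : x ≠ y) (hx : x ∈ T) (hy : y ∈ T) (hx' : x ∈ T') (hy' : y ∈ T') : T = T' := by
  have hTf : T.Finite := M.ground_finite.subset hT.subset_ground
  have hT'f : T'.Finite := M.ground_finite.subset hT'.subset_ground
  have hsub : T ∪ T' ⊆ M.closure {x, y} :=
    union_subset (tri_subset_closure_pair M hT h3 hx hy hxy) (tri_subset_closure_pair M hT' h3' hx' hy' hxy)
  have hr : M.eRk (T ∪ T') ≤ 2 := by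
    have h1 : M.eRk (T ∪ T') ≤ M.eRk (M.closure {x, y}) := M.eRk_mono hsub
    rw [Matroid.eRk_closure_eq] at h1
    have h2 : M.eRk {x, y} ≤ M.eRk T := M.eRk_mono (by
      intro s hs; simp only [mem_insert_iff, mem_singleton_iff] at hs; rcases hs with rfl | rfl <;> assumption)
    rw [eRk_eq_two_of_tri M hT h3] at h2
    exact h1.trans h2
  have hcard := ncard_le_three_of_eRk_le_two M hfree (union_subset hT.subset_ground hT'.subset_ground) hr
  have hTT' : T' ⊆ T := by
    have h := Set.ncard_union_add_ncard_inter T T' hTf hT'f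
    have hinter : (T ∩ T').ncard ≤ 3 := (ncard_le_ncard inter_subset_left hTf).trans (le_of_eq h3)
    have : 3 ≤ (T ∩ T').ncard := by omega
    have heq : T ∩ T' = T := Set.eq_of_subset_of_ncard_le inter_subset_left (by omega) hTf
    have heq' : T ∩ T' = T' := Set.eq_of_subset_of_ncard_le inter_subset_right (by omega) hT'f
    rw [← heq', heq]
  exact (hT'.eq_of_subset_isCircuit hT hTT').symm

/-- If `Y ⊆ cl X` then `X ∪ Y` has the rank of `X`. -/
theorem eRk_union_eq_of_subset_closure (M : Matroid α) {X Y : Set α} (hY : Y ⊆ M.closure X) :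
    M.eRk (X ∪ Y) = M.eRk X := by
  apply le_antisymm
  · have h1 : M.eRk (X ∪ Y) ≤ M.eRk (X ∪ M.closure X) := M.eRk_mono (union_subset_union_right X hY)
    rw [Matroid.eRk_union_closure_right_eq, union_self] at h1
    exact h1
  · exact M.eRk_mono subset_union_left

end S1

end PercRepro
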